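import Summits.Ventures.PercRepro.C041ZoneTailFree

/-!
# Locality: the sub-zones inside a zone are determined by the zone's own edges (p6, gen 26; C-041.md §11, the
zone split)

Setting of `C041ZoneTailFree`.  The EDGES OF A ZONE `Z` of `O` are the bare edges with both ends in `Z` and the
terminal edges at the vertices of `Z` (`ZoneEdge a b Z e`); a configuration `S` is BLUE-BELOW `O` when its blue bare
edges are blue in `O` (`BlueSub a b O S`; every cube state is).  For such `S`:

* a blue bare walk of `S` from a vertex of the zone `Z` stays in `Z` (`mem_zone_of_blueBareConn`) and uses only
  edges of `Z` (`blueBareConn_of_agree`: two configurations agreeing on `Z`'s edges have the same blue bare walks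
  from `Z`);
* hence `Attached`, the per-sub-zone conditions of (F2), are LOCAL to the zone (`attached_iff_of_agree`,
  `adm_zone_iff_of_agree`);
* the red side: `RedIn a b S Z` (red bare edges inside `Z`), a red bare walk inside `Z` is a red bare walk
  (`reflTransGen_bareAdj_of_redIn`) and is local (`redIn_walk_of_agree`).

These are the facts the zone split needs to glue zone-states into a cube state and to read the global predicates
per zone; the split itself is the next module.
-/

namespace PercRepro

namespace MultiGraph

open Finset

variable {V E : Type*} {G : MultiGraph V E}

section ZoneEdge

variable (G) (a b : V)

/-- The edges of the zone `Z`: bare edges with both ends in `Z`, and the terminal edges at the vertices of `Z`. -/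
def ZoneEdge (Z : Finset V) (e : E) : Prop :=
  (G.Bare a b e ∧ G.fst e ∈ Z ∧ G.snd e ∈ Z) ∨ ∃ v ∈ Z, G.Joins e v a ∨ G.Joins e v b

/-- `S` is blue-below `O`: every blue bare edge of `S` is blue in `O`. -/
def BlueSub (O S : Config E) : Prop := ∀ e, G.Bare a b e → S e = false → O e = false

/-- Red bare adjacency of `S` inside the zone `Z`. -/
def RedIn (S : Config E) (Z : Finset V) (u v : V) : Prop :=
  ∃ e, G.ZoneEdge a b Z e ∧ G.Bare a b e ∧ S e = true ∧ G.Joins e u v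

variable {G a b}

/-- A cube state is blue-below its bare colouring. -/
theorem blueSub_of_cube {O S : Config E} (hS : ∀ e, G.Bare a b e → O e = true → S e = true) :
    G.BlueSub a b O S := by
  intro e he hSe
  by_contra h
  have hO : O e = true := by
    cases h' : O e
    · exact absurd h' h
    · rfl
  rw [hS e he hO] at hSe
  exact absurd hSe (by decide)

/-- A bare edge joining two vertices of `Z` is an edge of `Z`. -/
theorem zoneEdge_of_joins {Z : Finset V} {e : E} (he : G.Bare a b e) {u v : V} (hj : G.Joins e u v)
    (hu : u ∈ Z) (hv : v ∈ Z) : G.ZoneEdge a b Z e := by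
  left
  refine ⟨he, ?_, ?_⟩ <;> rcases hj with ⟨h1, h2⟩ | ⟨h1, h2⟩
  · exact h1 ▸ hu
  · exact h1 ▸ hv
  · exact h2 ▸ hv
  · exact h2 ▸ hu

/-- A terminal edge at a vertex of `Z` is an edge of `Z`. -/
theorem zoneEdge_of_terminal {Z : Finset V} {e : E} {v t : V} (hv : v ∈ Z) (ht : t = a ∨ t = b)
    (hj : G.Joins e v t) : G.ZoneEdge a b Z e := by
  right
  refine ⟨v, hv, ?_⟩
  rcases ht with rfl | rfl
  · exact Or.inl hj
  · exact Or.inr hj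

/-- A blue bare adjacency of `S` is one of `O` when `S` is blue-below `O`. -/
theorem blueBareAdj_mono {O S : Config E} (hsub : G.BlueSub a b O S) {u v : V}
    (h : G.BlueBareAdj a b S u v) : G.BlueBareAdj a b O u v := by
  obtain ⟨e, he, hSe, hj⟩ := h
  exact ⟨e, he, hsub e he hSe, hj⟩

/-- A blue bare walk of `S` from a vertex of the zone `Z = zone z` stays in `Z`. -/
theorem mem_zone_of_blueBareConn [Fintype V] {O S : Config E} (hsub : G.BlueSub a b O S) {z v w : V}
    (hv : v ∈ G.zone a b O z) (h : G.BlueBareConn a b S v w) : w ∈ G.zone a b O z := by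
  rw [mem_zone] at hv ⊢
  refine hv.trans ?_
  induction h with
  | refl => exact BlueBareConn.refl a b O v
  | tail _ hbc ih => exact ih.tail (blueBareAdj_mono hsub hbc)

/-- **Locality of the blue bare walks**: two configurations blue-below `O` that agree on the edges of the zone
`Z = zone z` have the same blue bare walks from a vertex of `Z`. -/
theorem blueBareConn_of_agree [Fintype V] {O S S' : Config E} (hsub : G.BlueSub a b O S) {z : V}
    (hagree : ∀ e, G.ZoneEdge a b (G.zone a b O z) e → S' e = S e) {v w : V} (hv : v ∈ G.zone a b O z)
    (h : G.BlueBareConn a b S v w) : G.BlueBareConn a b S' v w := by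
  induction h with
  | refl => exact BlueBareConn.refl a b S' v
  | @tail x y hvx hxy ih =>
    obtain ⟨e, he, hSe, hj⟩ := hxy
    have hx : x ∈ G.zone a b O z := mem_zone_of_blueBareConn hsub hv hvx
    have hy : y ∈ G.zone a b O z := mem_zone_of_blueBareConn hsub hv (hvx.tail ⟨e, he, hSe, hj⟩)
    refine ih.tail ⟨e, he, ?_, hj⟩
    rw [hagree e (zoneEdge_of_joins he hj hx hy)]
    exact hSe

/-- **Locality of the attachments**: for `S`, `S'` blue-below `O` agreeing on the edges of the zone of `z`,
a vertex of that zone has the same attachments in `S` and in `S'`. -/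
theorem attached_iff_of_agree [Fintype V] {O S S' : Config E} (hsub : G.BlueSub a b O S) (hsub' : G.BlueSub a b O S')
    {z : V} (hagree : ∀ e, G.ZoneEdge a b (G.zone a b O z) e → S' e = S e) {v : V}
    (hv : v ∈ G.zone a b O z) {t : V} (ht : t = a ∨ t = b) :
    G.Attached a b S v t ↔ G.Attached a b S' v t := by
  have hagree' : ∀ e, G.ZoneEdge a b (G.zone a b O z) e → S e = S' e := fun e he => (hagree e he).symm
  constructor
  · rintro ⟨w, hvw, e, hSe, hj⟩
    refine ⟨w, blueBareConn_of_agree hsub hagree hv hvw, e, ?_, hj⟩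
    rw [hagree e (zoneEdge_of_terminal (mem_zone_of_blueBareConn hsub hv hvw) ht hj)]
    exact hSe
  · rintro ⟨w, hvw, e, hSe, hj⟩
    refine ⟨w, blueBareConn_of_agree hsub' hagree' hv hvw, e, ?_, hj⟩
    rw [hagree' e (zoneEdge_of_terminal (mem_zone_of_blueBareConn hsub' hv hvw) ht hj)]
    exact hSe

/-- The per-sub-zone condition of (F2) on a zone is local to the zone's edges. -/
theorem adm_zone_iff_of_agree [Fintype V] {O S S' : Config E} (hsub : G.BlueSub a b O S) (hsub' : G.BlueSub a b O S')
    {z : V} (hagree : ∀ e, G.ZoneEdge a b (G.zone a b O z) e → S' e = S e) :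
    (∀ v ∈ G.zone a b O z, ¬ (G.Attached a b S v a ∧ G.Attached a b S v b)) ↔
      (∀ v ∈ G.zone a b O z, ¬ (G.Attached a b S' v a ∧ G.Attached a b S' v b)) := by
  apply forall_congr'
  intro v
  apply imp_congr_right
  intro hv
  rw [attached_iff_of_agree hsub hsub' hagree hv (Or.inl rfl), attached_iff_of_agree hsub hsub' hagree hv (Or.inr rfl)]

/-- A red bare walk inside `Z` is a red bare walk. -/
theorem reflTransGen_bareAdj_of_redIn {S : Config E} {Z : Finset V} {u v : V}
    (h : Relation.ReflTransGen (G.RedIn a b S Z) u v) : Relation.ReflTransGen (G.BareAdj a b S) u v := by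
  induction h with
  | refl => exact Relation.ReflTransGen.refl
  | tail _ hbc ih =>
    obtain ⟨e, _, he, hSe, hj⟩ := hbc
    exact ih.tail ⟨e, he, hSe, hj⟩

/-- A red bare walk inside `Z` from a vertex of `Z` stays in `Z`. -/
theorem mem_of_redIn_walk {S : Config E} {Z : Finset V} {u v : V} (hu : u ∈ Z)
    (h : Relation.ReflTransGen (G.RedIn a b S Z) u v) : v ∈ Z := by
  induction h with
  | refl => exact hu
  | tail _ hbc ih =>
    obtain ⟨e, hZ, he, _, hj⟩ := hbc
    rcases hZ with ⟨_, h1, h2⟩ | ⟨w, hw, hj'⟩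
    · rcases hj with ⟨_, h4⟩ | ⟨h3, _⟩
      · exact h4 ▸ h2
      · exact h3 ▸ h1
    · exfalso
      rcases hj' with hj' | hj'
      · exact he.1 (EdgeAt.of_joins_right hj')
      · exact he.2 (EdgeAt.of_joins_right hj')

/-- **Locality of the red bare walks inside a zone**: configurations agreeing on the edges of `Z` have the same red
bare walks inside `Z`. -/
theorem redIn_walk_of_agree {S S' : Config E} {Z : Finset V} (hagree : ∀ e, G.ZoneEdge a b Z e → S' e = S e)
    {u v : V} (h : Relation.ReflTransGen (G.RedIn a b S Z) u v) :
    Relation.ReflTransGen (G.RedIn a b S' Z) u v := by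
  induction h with
  | refl => exact Relation.ReflTransGen.refl
  | tail _ hbc ih =>
    obtain ⟨e, hZ, he, hSe, hj⟩ := hbc
    refine ih.tail ⟨e, hZ, he, ?_, hj⟩
    rw [hagree e hZ]
    exact hSe

end ZoneEdge

end MultiGraph

end PercRepro
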